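import Literature.Computability.AlgebraicComplexity.DGIJLLiftingFrame
import Mathlib.Logic.Equiv.Fintype
import HarnessLib

/-!
# DGIJL Prop. 4.12 by explicit tableaux, III: regular relabellings and the uniform fibre count

Topic `Literature/Computability/AlgebraicComplexity`; proofs + two plumbing definitions (no named
facts), companion of `DGIJLLiftingFrame.lean`. In the value `F_T(A · p) = (d!)^{10d+15} Σ_φ Π_c det_c`
of a filling's tableau polynomial at `A · p` (tree `Spec.aeval_tabPoly`, `Spec.term_eq`), only
the *regular* relabellings `φ` — those giving every full column `d + 1` distinct values — survive
(`Spec.term_eq_zero_of_not_regular`). Regularity is invariant under permutations of the values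
(`Spec.regular_comp_iff`), and therefore the number of regular `φ` with prescribed values on a set
of "class representatives" is the same for all injective prescriptions; this gives the counting
identity `Spec.sum_regular_eq`:

  `Σ_φ [φ regular] f(φ ∘ rep) = #{φ regular | φ ∘ rep = v₀} · Σ_{v injective} f(v)`

for any fixed injective `v₀`, whenever regular `φ` are injective on `rep`. This is the bookkeeping
that turns the five explicit fillings into closed-form values at the evaluation points (design
note of the cell `val-lit`: `run/shared/lean/pub/val-lit/bip/DGIJL-Prop412-DESIGN-p6.md`) for

* Dutta–Gesmundo–Ikenmeyer–Jindal–Lysikov, arXiv:2211.07055, **Prop. 4.12**.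

Honest framing: combinatorial plumbing for a kernel certificate of a printed theorem; nothing here
bears on VP versus VNP.
-/

noncomputable section

open scoped BigOperators

namespace Literature.Computability.AlgebraicComplexity

namespace DGIJLLift

open TableauEval

variable {k : ℕ}

/-! ### §1 Value vectors of full columns; regular relabellings -/

/-- The value vector of the full column `c` under the relabelling `φ`: row `r ↦ φ (lab c r)`.
[cite: IkenmeyerKandasamy2019, Thm. 11.1] -/
def Spec.colw (S : Spec k) (φ : Fin (20 * k + 55) → Fin (2 * k + 5)) (c : ℕ) :
    Fin (2 * k + 5) → Fin (2 * k + 5) :=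
  fun r => extF k φ (S.lab c r)

/-- **Regular relabelling**: every full column receives `d + 1` distinct values (IK §13: "for which
`φ(T)` is regular"). [cite: IkenmeyerKandasamy2019, §13 (Thm. 4.2)] -/
def Spec.Regular (S : Spec k) (φ : Fin (20 * k + 55) → Fin (2 * k + 5)) : Prop :=
  ∀ c, c < 20 * k + 40 → Function.Injective (S.colw φ c)

/-- A non-regular relabelling kills the product of the full-column determinants.
[cite: IkenmeyerKandasamy2019, Thm. 11.1] -/
theorem Spec.prod_fullDet_eq_zero_of_not_regular (S : Spec k)
    (A : Matrix (Fin (2 * k + 5)) (Fin (2 * k + 5)) ℂ) (φ : Fin (20 * k + 55) → Fin (2 * k + 5))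
    (h : ¬ S.Regular φ) :
    ∏ c ∈ Finset.range (20 * k + 40), fullDet k A (fun r => extF k φ (S.lab c r)) = 0 := by
  unfold Spec.Regular at h
  simp only [not_forall] at h
  obtain ⟨c, hc, hinj⟩ := h
  exact Finset.prod_eq_zero (Finset.mem_range.mpr hc) (fullDet_eq_zero_of_not_injective hinj)

/-- **Only regular relabellings contribute** to `F_T(A · p)`. [cite: IkenmeyerKandasamy2019, Thm. 11.1] -/
theorem Spec.term_eq_zero_of_not_regular (S : Spec k)
    (A : Matrix (Fin (2 * k + 5)) (Fin (2 * k + 5)) ℂ) (φ : Fin (20 * k + 55) → Fin (2 * k + 5))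
    (h : ¬ S.Regular φ) :
    ∏ c : Fin (30 * k + 59), colVal k A φ (hgt k c) (S.lab c) = 0 := by
  rw [S.term_eq, S.prod_fullDet_eq_zero_of_not_regular A φ h, zero_mul, zero_mul]

/-! ### §2 Permuting the values -/

/-- `extF` commutes with post-composition by a permutation (on labels).
[cite: IkenmeyerKandasamy2019, §13 (Thm. 4.2)] -/
theorem extF_comp (π : Equiv.Perm (Fin (2 * k + 5))) (φ : Fin (20 * k + 55) → Fin (2 * k + 5))
    {u : ℕ} (hu : u < 20 * k + 55) : extF k (π ∘ φ) u = π (extF k φ u) := by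
  rw [extF_of_lt k _ hu, extF_of_lt k _ hu]
  rfl

/-- The value vector of a full column transforms by post-composition.
[cite: IkenmeyerKandasamy2019, §13 (Thm. 4.2)] -/
theorem Spec.colw_comp (S : Spec k) (π : Equiv.Perm (Fin (2 * k + 5)))
    (φ : Fin (20 * k + 55) → Fin (2 * k + 5)) {c : ℕ} (hc : c < 20 * k + 40) :
    S.colw (π ∘ φ) c = π ∘ S.colw φ c := by
  funext r
  unfold Spec.colw
  have hr : (r : ℕ) < hgt k c := by unfold hgt; rw [if_pos hc]; exact r.2
  exact extF_comp π φ (S.lab_lt (by omega) hr)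

/-- **Regularity is invariant under permutations of the values.**
[cite: IkenmeyerKandasamy2019, §13 (proof of (∗))] -/
theorem Spec.regular_comp_iff (S : Spec k) (π : Equiv.Perm (Fin (2 * k + 5)))
    (φ : Fin (20 * k + 55) → Fin (2 * k + 5)) : S.Regular (π ∘ φ) ↔ S.Regular φ := by
  constructor
  · intro h c hc
    have h' := h c hc
    rw [S.colw_comp π φ hc] at h'
    exact Function.Injective.of_comp h'
  · intro h c hc
    rw [S.colw_comp π φ hc]
    exact π.injective.comp (h c hc)

/-! ### §3 The uniform fibre count and the counting identity -/

/-- The number of regular relabellings with prescribed values `v` on the representatives `rep`.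
[cite: IkenmeyerKandasamy2019, §13 (Thm. 4.2, (∗))] -/
def Spec.fibreCount (S : Spec k) {kc : ℕ} (rep : Fin kc → Fin (20 * k + 55))
    (v : Fin kc → Fin (2 * k + 5)) : ℕ := by
  classical
  exact (Finset.univ.filter fun φ : Fin (20 * k + 55) → Fin (2 * k + 5) =>
    S.Regular φ ∧ φ ∘ rep = v).card

/-- **The fibre count is the same for all injective prescriptions** (IK's "(∗): each tableau in
`𝔖_m S` has exactly `α` many preimages"): a permutation `π` of the values with `π ∘ v₀ = v`
(Mathlib `Equiv.Perm.exists_extending_pair`) maps `{φ regular | φ ∘ rep = v₀}` bijectively onto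
`{φ regular | φ ∘ rep = v}`. [cite: IkenmeyerKandasamy2019, §13 (Thm. 4.2, (∗))] -/
theorem Spec.fibreCount_eq (S : Spec k) {kc : ℕ} (rep : Fin kc → Fin (20 * k + 55))
    {v₀ v : Fin kc → Fin (2 * k + 5)} (hv₀ : Function.Injective v₀) (hv : Function.Injective v) :
    S.fibreCount rep v = S.fibreCount rep v₀ := by
  classical
  obtain ⟨π, hπ⟩ := Equiv.Perm.exists_extending_pair v₀ v hv₀ hv
  unfold Spec.fibreCount
  symm
  refine Finset.card_bij (fun φ _ => π ∘ φ) ?_ ?_ ?_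
  · intro φ hφ
    rw [Finset.mem_filter] at hφ ⊢
    refine ⟨Finset.mem_univ _, (S.regular_comp_iff π φ).mpr hφ.2.1, ?_⟩
    funext i
    change π (φ (rep i)) = v i
    rw [← hπ i, ← hφ.2.2]
    rfl
  · intro φ _ φ' _ h
    funext u
    exact π.injective (congrFun h u)
  · intro ψ hψ
    rw [Finset.mem_filter] at hψ
    refine ⟨π.symm ∘ ψ, ?_, ?_⟩
    · rw [Finset.mem_filter]
      refine ⟨Finset.mem_univ _, (S.regular_comp_iff π.symm ψ).mpr hψ.2.1, ?_⟩
      funext i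
      change π.symm (ψ (rep i)) = v₀ i
      rw [Equiv.symm_apply_eq, hπ i, ← hψ.2.2]
      rfl
    · funext u
      change π (π.symm (ψ u)) = ψ u
      exact π.apply_symm_apply _

/-- The fibre over a non-injective prescription is empty when regular relabellings are injective on
the representatives. [cite: IkenmeyerKandasamy2019, §13 (Thm. 4.2)] -/
theorem Spec.fibreCount_eq_zero (S : Spec k) {kc : ℕ} (rep : Fin kc → Fin (20 * k + 55))
    (hinj : ∀ φ, S.Regular φ → Function.Injective (φ ∘ rep))
    {v : Fin kc → Fin (2 * k + 5)} (hv : ¬ Function.Injective v) : S.fibreCount rep v = 0 := by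
  classical
  unfold Spec.fibreCount
  rw [Finset.card_eq_zero, Finset.filter_eq_empty_iff]
  intro φ _ h
  exact hv (h.2 ▸ hinj φ h.1)

/-- **The counting identity.** If regular relabellings are injective on the representatives `rep`,
then for every `f` and every injective prescription `v₀`:
`Σ_φ [φ regular] f(φ ∘ rep) = #{φ regular | φ ∘ rep = v₀} · Σ_{v injective} f(v)`.
[cite: IkenmeyerKandasamy2019, §13 (proof of Thm. 4.2)] -/
theorem Spec.sum_regular_eq (S : Spec k) {kc : ℕ} (rep : Fin kc → Fin (20 * k + 55))
    (f : (Fin kc → Fin (2 * k + 5)) → ℂ)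
    (hinj : ∀ φ, S.Regular φ → Function.Injective (φ ∘ rep))
    {v₀ : Fin kc → Fin (2 * k + 5)} (hv₀ : Function.Injective v₀)
    [DecidablePred S.Regular] [DecidablePred (Function.Injective : (Fin kc → Fin (2 * k + 5)) → Prop)] :
    ∑ φ : Fin (20 * k + 55) → Fin (2 * k + 5), (if S.Regular φ then f (φ ∘ rep) else 0) =
      (S.fibreCount rep v₀ : ℂ) *
        ∑ v : Fin kc → Fin (2 * k + 5), (if Function.Injective v then f v else 0) := by
  classical
  -- regroup the sum over `φ` by the values `φ ∘ rep`
  rw [← Finset.sum_fiberwise Finset.univ (fun φ : Fin (20 * k + 55) → Fin (2 * k + 5) => φ ∘ rep)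
    (fun φ => if S.Regular φ then f (φ ∘ rep) else 0)]
  rw [Finset.mul_sum]
  refine Finset.sum_congr rfl fun v _ => ?_
  -- the inner sum over the fibre of `v`
  have hfib : ∑ φ ∈ Finset.univ.filter (fun φ : Fin (20 * k + 55) → Fin (2 * k + 5) => φ ∘ rep = v),
      (if S.Regular φ then f (φ ∘ rep) else 0) = (S.fibreCount rep v : ℂ) * f v := by
    rw [Finset.sum_ite, Finset.sum_const_zero, add_zero]
    have hcongr : ∀ φ ∈ Finset.filter S.Regular
        (Finset.univ.filter (fun φ : Fin (20 * k + 55) → Fin (2 * k + 5) => φ ∘ rep = v)),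
        f (φ ∘ rep) = f v := by
      intro φ hφ
      rw [Finset.mem_filter, Finset.mem_filter] at hφ
      rw [hφ.1.2]
    rw [Finset.sum_congr rfl hcongr, Finset.sum_const, nsmul_eq_mul]
    congr 1
    unfold Spec.fibreCount
    norm_cast
    congr 1
    ext φ
    simp only [Finset.mem_filter, Finset.mem_univ, true_and]
    exact and_comm
  rw [hfib]
  by_cases hv : Function.Injective v
  · rw [if_pos hv, S.fibreCount_eq rep hv₀ hv]
  · rw [if_neg hv, mul_zero, S.fibreCount_eq_zero rep hinj hv, Nat.cast_zero, zero_mul]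

/-- **Nonvanishing form.** With a witness `φ₀` (regular, `φ₀ ∘ rep = v₀`), the fibre count is
positive, so `Σ_φ [φ regular] f(φ ∘ rep)` vanishes iff `Σ_{v injective} f(v)` does.
[cite: IkenmeyerKandasamy2019, §13 (Thm. 4.2 (3))] -/
theorem Spec.fibreCount_pos (S : Spec k) {kc : ℕ} (rep : Fin kc → Fin (20 * k + 55))
    {v₀ : Fin kc → Fin (2 * k + 5)} {φ₀ : Fin (20 * k + 55) → Fin (2 * k + 5)}
    (hreg : S.Regular φ₀) (hφ₀ : φ₀ ∘ rep = v₀) : 0 < S.fibreCount rep v₀ := by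
  classical
  unfold Spec.fibreCount
  rw [Finset.card_pos]
  exact ⟨φ₀, Finset.mem_filter.mpr ⟨Finset.mem_univ _, hreg, hφ₀⟩⟩

end DGIJLLift

end Literature.Computability.AlgebraicComplexity

end
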